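import Summits.ResolutionOfSingularities.KangarooAtlas.MizutaniDiffPairing
import Mathlib.LinearAlgebra.Dual.Lemmas
import HarnessLib

/-!
# Mizutani's conjecture `m(e) = 2p^e − 1` — duality: the powers of the diagonal ideal of a field extension

Cell topic `Summits/ResolutionOfSingularities/KangarooAtlas` (pub-rosobs); namespace
`Summit.ResolutionOfSingularities.KangarooAtlas.Mizutani`.  Part of the Lean transcription of the
in-house note MIZUTANI-PROOF-g59 (AI-written, AI-audited; *AI review is weaker than expert review*; not a
resolution theorem).  §3 DICTIONARY, step (B): for fields `K ⊆ k` and `J ⊂ k ⊗_K k` the kernel of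
multiplication,

  `ρ ∈ J^{m+1}  ⟺  (D ⊗ 1)ρ ↦ 0 under multiplication for every differential operator D of k/K of order ≤ m`

(`mem_ideal_pow_iff_forall_dPair`).  "⟹" is EGA IV 16.8.8 (`MizutaniDiffPairing`); "⟸" is linear duality:
`J^{m+1}` is a `k`-subspace of `k ⊗_K k`, a vector outside it is separated from it by a `k`-linear functional,
and every (right-)`k`-linear functional on `k ⊗_K k` is the pairing of some `K`-linear `D` (whose order is then
`≤ m` by 16.8.8).  This is the mechanism behind Oda's identification of `Diff(F^{-∞}(k)/k)` with functionals on
`F^{-∞}(k) ⊗_k F^{-∞}(k)` and his description of the invariant additive forms (Oda 1983-II §1–§2); in the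
chain it turns the DEFINITION of `invForms` (`Literature/…/HironakaGroupScheme.lean`) into membership in `J^q`.

References: [EGAIV4] Prop. 16.8.8; [Oda1983HironakaGroupSchemeII] §1 (p. 1165), §2 (p. 1168).
-/

open TensorProduct Literature.AlgebraicGeometry.Resolution

namespace Summit.ResolutionOfSingularities.KangarooAtlas.Mizutani

section Duality

variable (K : Type*) {k : Type*} [Field K] [Field k] [Algebra K k]

/-- The flip `x ⊗ y ↦ y ⊗ x` preserves the diagonal ideal `J = ker(k ⊗_K k → k)`. [folklore] -/
theorem map_comm_ideal_le :
    (KaehlerDifferential.ideal K k).map (Algebra.TensorProduct.comm K k k) ≤ KaehlerDifferential.ideal K k := by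
  rw [← KaehlerDifferential.span_range_eq_ideal, Ideal.map_span, Ideal.span_le]
  rintro _ ⟨_, ⟨s, rfl⟩, rfl⟩
  have : (Algebra.TensorProduct.comm K k k) ((1 : k) ⊗ₜ[K] s - s ⊗ₜ[K] 1) = -((1 : k) ⊗ₜ[K] s - s ⊗ₜ[K] 1) := by
    rw [map_sub, Algebra.TensorProduct.comm_tmul, Algebra.TensorProduct.comm_tmul, neg_sub]
  rw [this]
  exact Submodule.neg_mem _ (Ideal.subset_span ⟨s, rfl⟩)

/-- The flip preserves the powers `J^n`. [folklore] -/
theorem comm_mem_ideal_pow {n : ℕ} {ρ : k ⊗[K] k} (hρ : ρ ∈ KaehlerDifferential.ideal K k ^ n) :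
    (Algebra.TensorProduct.comm K k k) ρ ∈ KaehlerDifferential.ideal K k ^ n := by
  have h := Ideal.mem_map_of_mem (Algebra.TensorProduct.comm K k k) hρ
  rw [Ideal.map_pow] at h
  exact Ideal.pow_right_mono (map_comm_ideal_le K) n h

/-- A `k`-linear functional `f` on `k ⊗_K k` (left structure) is the pairing of the `K`-linear operator
`D x := f (1 ⊗ x)` composed with the flip: `f (comm w) = dPair id D w`. [cite: Oda1983HironakaGroupSchemeII, §1 (p. 1165: D ↦ the functional)] -/
noncomputable def dualOp (f : Module.Dual k (k ⊗[K] k)) : k →ₗ[K] k where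
  toFun x := f ((1 : k) ⊗ₜ[K] x)
  map_add' x y := by rw [TensorProduct.tmul_add, map_add]
  map_smul' c x := by
    rw [RingHom.id_apply, ← TensorProduct.smul_tmul, ← TensorProduct.smul_tmul', LinearMap.map_smul_of_tower]

/-- `dualOp f x = f (1 ⊗ x)`. [folklore] -/
@[simp] theorem dualOp_apply (f : Module.Dual k (k ⊗[K] k)) (x : k) : dualOp K f x = f ((1 : k) ⊗ₜ[K] x) := rfl

/-- `dPair id (dualOp f) w = f (comm w)`. [cite: Oda1983HironakaGroupSchemeII, §1 (p. 1165)] -/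
theorem dPair_dualOp (f : Module.Dual k (k ⊗[K] k)) (w : k ⊗[K] k) :
    dPair K (AlgHom.id K k) (dualOp K f) w = f ((Algebra.TensorProduct.comm K k k) w) := by
  induction w using TensorProduct.induction_on with
  | zero => rw [map_zero, map_zero, map_zero]
  | tmul x y =>
    rw [dPair_tmul, AlgHom.id_apply, dualOp_apply, Algebra.TensorProduct.comm_tmul, mul_comm, ← smul_eq_mul,
      ← map_smul, TensorProduct.smul_tmul', smul_eq_mul, mul_one]
  | add w₁ w₂ h₁ h₂ => rw [map_add, map_add, map_add, h₁, h₂]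

/-- **Duality for the powers of the diagonal ideal** (MIZUTANI-PROOF-g59 §1.4 `(P1)`–`(P2)` made intrinsic;
Oda 1983-II §1): for fields `K ⊆ k`, `ρ ∈ k ⊗_K k` lies in `J^{m+1}` (`J = ker` of multiplication) iff
`x ⊗ y ↦ D(x)·y` kills `ρ` for every differential operator `D` of `k` over `K` of order `≤ m`.
[cite: Oda1983HironakaGroupSchemeII, §1 (p. 1165–1166: 𝒟^{(r)} and Δ^{(r)}); EGAIV4, Prop. 16.8.8] -/
theorem mem_ideal_pow_iff_forall_dPair (m : ℕ) (ρ : k ⊗[K] k) :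
    ρ ∈ KaehlerDifferential.ideal K k ^ (m + 1) ↔
      ∀ D : k →ₗ[K] k, IsDiffOpLE K m D → dPair K (AlgHom.id K k) D ρ = 0 := by
  constructor
  · intro hρ D hD
    exact (isDiffOpLE_iff_dPair K m D).mp hD ρ hρ
  · intro h
    by_contra hρ
    -- the flip is an involution
    have hcc : ∀ w : k ⊗[K] k,
        (Algebra.TensorProduct.comm K k k) ((Algebra.TensorProduct.comm K k k) w) = w := by
      intro w
      induction w using TensorProduct.induction_on with
      | zero => rw [map_zero, map_zero]
      | tmul x y => rw [Algebra.TensorProduct.comm_tmul, Algebra.TensorProduct.comm_tmul]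
      | add a b ha hb => rw [map_add, map_add, ha, hb]
    -- the flipped element is outside `J^{m+1}` as well
    set ρ' := (Algebra.TensorProduct.comm K k k) ρ with hρ'
    have hρ'not : ρ' ∉ KaehlerDifferential.ideal K k ^ (m + 1) := by
      intro h'
      apply hρ
      have := comm_mem_ideal_pow K h'
      rwa [hρ', hcc] at this
    -- separate it from the `k`-subspace `J^{m+1}` by a `k`-linear functional
    set W : Submodule k (k ⊗[K] k) := (KaehlerDifferential.ideal K k ^ (m + 1)).restrictScalars k with hW
    have hρ'W : ρ' ∉ W := hρ'not
    obtain ⟨f, hfρ, hfW⟩ := Submodule.exists_dual_map_eq_bot_of_notMem hρ'W inferInstance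
    -- the functional is the pairing of `dualOp f`, an operator of order `≤ m`
    have hD : IsDiffOpLE K m (dualOp K f) := by
      refine (isDiffOpLE_iff_dPair K m _).mpr fun w hw => ?_
      rw [dPair_dualOp]
      have : f ((Algebra.TensorProduct.comm K k k) w) ∈ W.map f :=
        Submodule.mem_map_of_mem (comm_mem_ideal_pow K hw)
      rwa [hfW, Submodule.mem_bot] at this
    have := h _ hD
    rw [dPair_dualOp] at this
    exact hfρ this

/-- Corollary: `J^{m+1}` is the joint kernel of the pairings of all operators of order `≤ m`; in
particular an element killed by all of them and NOT killed by some pairing `dPair id D` (any `K`-linear `D`)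
witnesses `ρ ∈ J^{m+1}` with `D` of order `> m`. Stated as: `ρ ∉ J^{m+1}` gives an operator of order `≤ m`
detecting it. [cite: Oda1983HironakaGroupSchemeII, §1 (p. 1165)] -/
theorem exists_isDiffOpLE_dPair_ne_zero {m : ℕ} {ρ : k ⊗[K] k}
    (hρ : ρ ∉ KaehlerDifferential.ideal K k ^ (m + 1)) :
    ∃ D : k →ₗ[K] k, IsDiffOpLE K m D ∧ dPair K (AlgHom.id K k) D ρ ≠ 0 := by
  by_contra h
  push Not at h
  exact hρ ((mem_ideal_pow_iff_forall_dPair K m ρ).mpr h)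

end Duality

end Summit.ResolutionOfSingularities.KangarooAtlas.Mizutani
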